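import Summits.QuantumFields.YangMills.Theorems.BalabanUVNodesN09ChartReadAveragingSmooth
import Literature.MeasureTheory.Integral.SubmersionPushforwardDensity
import HarnessLib

/-!
# BalabanUVNodes ∕ N09 — (M3r)-LOCAL, FILE 2∕2: THE CHART-READ (0.4) EML BLOCK AVERAGE HAS ONTO DERIVATIVE AT `0` FOR EVERY FINE CONFIGURATION OF THE α-GUARD ⇒ (n09-w2's engine +
# chart transport + gluing, BY NAME) the FLAT and the GROUP-LEVEL local Jacobian faces of `Ū` and a CONTINUOUS push-forward density for every continuous density supported in the guard

Cell `pub-ymgap`, width seat `pub-ymgap-dag-n09-w4` generation 5 (HUMAN RULING D-0149; DAG node N09 = [Balaban1987RG1] §§2–5; INBOX CLAIM-1∕INTENT-1 l.32428).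
`--kind proof --supports stmt-QuantumFields-26907 --as helper` (K1⁸; count-neutral; theorems only, 0 def ∕ 0 instance ∕ 0 notation ∕ 0 sorry).  File 1 = `…N09ChartReadAveragingSmooth`.

CONTENTS (CONSUMED BY NAME, nothing modified: file 1; dag-n07-w2's `…N07CentralResponseOnto.centralResponse_onto_sharp` and FACT (A) `…N07CentralDescendantLifts.
fderiv_avgM_apply_eq_zero_of_supported_centralBond`; dag-n09-w2's p610570 `SubmersionPushforward.exists_continuousOn_density_map_of_submersion` and `HaarExpChartLocalFaceTransport`
(`flatFace_chartRead_of_engineFace`, `localFace_pi_haar_of_chartRead`, `exists_continuous_density_pi_haar_of_flatLocalFaces`, `piLogChart_translate_self`); this seat's g4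
`FieldMeasureExpChartChangeOfVariables` (`isHaarMeasure_haar_specialUnitaryGroup`, `isMulRightInvariant_haar`, `fieldMeasure_eq_pi`); `BlockAveraging.measurable_avgFun`).
§3 ★ `coe_fderiv_chartRead_single_apply` (the `c″`-component of `Dψ_{U₀}(0)[X δ_β]` is `D(W ↦ avgM W c″)(↑U₀)[X·↑U₀(β)·δ_β]·↑Ū(U₀)(c″)⋆`); ★★ `fderiv_chartRead_single_apply_of_ne`
(BLOCK-TRIANGULAR on the central bonds: FACT (A)); ★★★ `exists_fderiv_chartRead_single_apply_self` (diagonal blocks ONTO: `centralResponse_onto_sharp` conjugated by the chart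
conventions, `X = Ad_{U₀(β)}Y`, `Y′ = Ad_{Ū(U₀)(c)}⁻¹ z`); ★★★ `fderiv_chartRead_avgFun_range_eq_top`.  §4 ★★★ `engineFace_chartRead_avgFun` (p610570 applied: the FLAT
engine-form face at `0` w.r.t. `⊗η`); `flatFace_chartRead_avgFun` (the `hflat` shape, idle exemption `Q ≡ True`); `localFace_avgFun_of_loopSmall` (the local face of `Ū` on
`SU(N)^{B_j}` w.r.t. product Haar = the per-point clause of `PushforwardDensityGluing.exists_continuous_density_of_locally'`); ★★★ `exists_continuous_density_avgFun_of_loopSmall`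
(closed `K₀` inside the α-guard, `r ≥ 0` measurable bounded, zero off `K₀`, continuous on `K₀` ⇒ a push-forward density CONTINUOUS on all of `SU(N)^{B_{j+1}}`, set identity + (0.13)
test identity).  §5 at NODE 00's objects (`avOfRecord`, `fieldMeasure`, `k < K`): `continuousAt_and_flatFace_avOfRecord` (= the per-configuration input of dag-n09-w2's
`Node00.RegSetOfLocalFaces` §2, idle exemption), ★★★ `exists_continuous_density_TOfRecord_of_loopSmall`.

DISPLAYED HYPOTHESES.  Standing range `j + 1 ≤ m + K` (`k < K`); the loop `α`-guard: `dist1 (loopHol U₀ c i) ≤ α` for all `c`, `i` (at `U₀`, resp. on `K₀`), `α ≤ 1∕24`, `α < δ_N`,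
`157·α < L^{1−d}` (dag-n07-w2's constants, not optimised); for the glued density `r`: measurable, bounded, `≥ 0`, zero off the closed `K₀`, continuous at the points of `K₀`.

HONEST FRAMING.  LOCATED, count-neutral kernel calculus ∕ bookkeeping on the tree's OWN (0.4) averaging; NO chart of Bałaban's is constructed (print's (2.10) linearisation
`B′ = B − hD̃(B)` around `V^{(k)}(W)` is NOT touched — the implicit-function fibre coordinates of the engine stand in for the existence∕continuity statement only); NO estimate of
Bałaban's; the exemption is IDLE (`Q ≡ True`): the record's density `ρ_k χ_k` is NOT continuous across the (2.9) thresholds, so `hreg` at the record still needs the SHARP engine p613264 +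
the thresholds' transversality (located, not here); `hreg`∕`contTOn`∕`regSet`∕`TcanOfRecord` NOT discharged; N09 NOT discharged; conjunct 1 (Lemma 4) ∕ FLAG №7 untouched; K0⁷ ∕ K1⁸ ∕
K3⁷ NOT closed; counts unmoved (typed 28∕28 · discharged 5∕28); no summit statement is proved here; R4 = the conditional finite-𝕋⁴ rung `BalabanLadder.UV` only — NOT continuum ∕
ℝ⁴ ∕ OS; the Yang–Mills mass gap (Clay) is NOT proved by any of this.
-/

noncomputable section

open scoped Matrix.Norms.L2Operator Topology ENNReal
open Filter Set Function MeasureTheory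

namespace Summit.QuantumFields.YangMills.BalabanUVNodes.N09ChartReadAveragingSubmersion

open Literature.MathematicalPhysics.QuantumFieldTheory.Balaban1983to89
open Literature.MathematicalPhysics.QuantumFieldTheory.Balaban1983to89.HaarExponentialChart
open Literature.MathematicalPhysics.QuantumFieldTheory.Balaban1983to89.HaarExponentialChart.IsChartRep
open Literature.MathematicalPhysics.QuantumFieldTheory.Balaban1983to89.BlockAveraging (Small Idx avgFun loopHol)
open Literature.MathematicalPhysics.QuantumFieldTheory.Balaban1983to89.BlockAveragingHaarAC (centralBond IsCentral openHol pre post isLocal_avgFun)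
open Literature.MathematicalPhysics.QuantumFieldTheory.Balaban1983to89.ExpMeanLog (expMeanLogSU deltaSU)
open Literature.MathematicalPhysics.QuantumFieldTheory.Balaban1983to89.Node00
open Literature.MathematicalPhysics.QuantumLattice (fundamentalRep fundamentalRep_apply)
open MatrixLog (mlog analyticAt_mlog mlog_one)

open Summit.QuantumFields.YangMills.BalabanUVNodes.N09ChartReadAveragingSmooth

/-! ## §3  `Dψ_{U₀}(0)`: block-triangular on the central bonds, ONTO diagonal blocks (dag-n07-w2) ⇒ ONTO -/
section Onto

variable {P : Params} {j : ℕ} {N : ℕ} [NeZero N]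
variable {U₀ : GaugeField P j (SU N)}

/-- ★ **THE CHART-READ DERIVATIVE ON ONE-BOND DIRECTIONS, IN MATRICES.**  On the guard, for every fine bond `β`, coarse bond `c″` and `X ∈ 𝔰𝔲(N)`:
`↑((Dψ_{U₀}(0)[X δ_β])(c″)) = D(W ↦ avgM W c″)(↑U₀)[X·↑U₀(β)·δ_β] · ↑Ū(U₀)(c″)⋆` — the response of the matrix extension of (0.4) (`Node00.AveragingSmooth.avgM`), read back through
`D log(1) = id` and the right translation by `Ū(U₀)(c″)⁻¹`. [cite: Balaban1987RG1, (0.4) p.253; Balaban1985Variational, (44) p.285] -/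
theorem coe_fderiv_chartRead_single_apply (hsmall : ∀ c, Small (expMeanLogSU (n := Fin N)) U₀ c) (β : PBond P j) (c'' : PBond P (j + 1))
    (X : (specialUnitaryLogChart (Fin N)).lie) :
    ((fderiv ℝ (fun (A : PBond P j → (specialUnitaryLogChart (Fin N)).lie) (c : PBond P (j + 1)) =>
      (isChartRep_specialUnitaryGroup (n := Fin N)).logChart
        (avgFun (expMeanLogSU (n := Fin N)) (fun b => (isChartRep_specialUnitaryGroup (n := Fin N)).expChart (A b) * U₀ b) c *
          (avgFun (expMeanLogSU (n := Fin N)) U₀ c)⁻¹)) 0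
      (Pi.single β X) c'' : (specialUnitaryLogChart (Fin N)).lie) : Matrix (Fin N) (Fin N) ℂ) =
      fderiv ℝ (fun W : PBond P j → Matrix (Fin N) (Fin N) ℂ => avgM W c'') (coeField U₀)
          (Pi.single β (((X : (specialUnitaryLogChart (Fin N)).lie) : Matrix (Fin N) (Fin N) ℂ) * ((U₀ β : SU N) : Matrix (Fin N) (Fin N) ℂ))) *
        star ((avgFun (expMeanLogSU (n := Fin N)) U₀ c'' : SU N) : Matrix (Fin N) (Fin N) ℂ) := by
  set h := isChartRep_specialUnitaryGroup (n := Fin N) with hh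
  set ψ := fun (A : PBond P j → (specialUnitaryLogChart (Fin N)).lie) (c : PBond P (j + 1)) =>
      h.logChart (avgFun (expMeanLogSU (n := Fin N)) (fun b => h.expChart (A b) * U₀ b) c * (avgFun (expMeanLogSU (n := Fin N)) U₀ c)⁻¹) with hψ
  set a : PBond P j → (specialUnitaryLogChart (Fin N)).lie := Pi.single β X with ha
  set s : Matrix (Fin N) (Fin N) ℂ := star ((avgFun (expMeanLogSU (n := Fin N)) U₀ c'' : SU N) : Matrix (Fin N) (Fin N) ℂ) with hs
  have hdiff : DifferentiableAt ℝ ψ 0 := (contDiffAt_chartRead_avgFun (P := P) (j := j) U₀ hsmall).differentiableAt (by simp)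
  have hcompF : HasFDerivAt (fun A => ψ A c'') ((ContinuousLinearMap.proj c'').comp (fderiv ℝ ψ 0)) 0 :=
    (hasFDerivAt_pi' (Φ := ψ) (Φ' := fderiv ℝ ψ 0) (x := (0 : PBond P j → (specialUnitaryLogChart (Fin N)).lie))).1 hdiff.hasFDerivAt c''
  have hcomp : DifferentiableAt ℝ (fun A => ψ A c'') 0 := hcompF.differentiableAt
  -- the component as the value of `fderiv` of the component map
  have hpi : fderiv ℝ ψ 0 a c'' = fderiv ℝ (fun A => ψ A c'') 0 a := by
    rw [hcompF.fderiv]; rfl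
  rw [hpi, coe_fderiv_apply_eq _ hcomp a]
  -- the matrix of the component: near `0` it is the model
  have heq := coe_chartRead_eventuallyEq (P := P) (j := j) U₀ hsmall c''
  rw [heq.fderiv_eq]
  have hcoediff : DifferentiableAt ℝ (fun A : PBond P j → (specialUnitaryLogChart (Fin N)).lie => ((ψ A c'' : (specialUnitaryLogChart (Fin N)).lie) :
      Matrix (Fin N) (Fin N) ℂ)) 0 :=
    ((specialUnitaryLogChart (Fin N)).lie.subtypeL.differentiableAt).comp (0 : PBond P j → (specialUnitaryLogChart (Fin N)).lie) hcomp
  have hmodeldiff : DifferentiableAt ℝ (fun A : PBond P j → (specialUnitaryLogChart (Fin N)).lie =>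
      mlog (avgM (coeField (fun b => h.expChart (A b) * U₀ b)) c'' * s)) 0 := heq.differentiableAt_iff.1 hcoediff
  -- two derivatives along the same ray
  have hrayD : HasDerivAt (fun t : ℝ => mlog (avgM (coeField (fun b => h.expChart ((t • a) b) * U₀ b)) c'' * s))
      (fderiv ℝ (fun A : PBond P j → (specialUnitaryLogChart (Fin N)).lie => mlog (avgM (coeField (fun b => h.expChart (A b) * U₀ b)) c'' * s)) 0 a) 0 :=
    hasDerivAt_along_ray hmodeldiff a
  have hform := hasDerivAt_model_ray (P := P) (j := j) U₀ hsmall c'' β X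
  exact hrayD.unique hform

/-- ★★ **FACT (A): THE OFF-DIAGONAL BLOCKS VANISH.**  For `c″ ≠ c` the `c″`-component of the chart-read average does not see the chart coordinate at the central bond `β(c)`:
`(Dψ_{U₀}(0)[X δ_{β(c)}])(c″) = 0` (n07-w2's `fderiv_avgM_apply_eq_zero_of_supported_centralBond`: the derivative of `avgM · c″` kills directions supported at `β(c)`).
[cite: Balaban1987RG1, (0.4) p.253; Balaban1985Averaging, p.19 (locality)] -/
theorem fderiv_chartRead_single_apply_of_ne (hj : j + 1 ≤ P.m + P.K) (hsmall : ∀ c, Small (expMeanLogSU (n := Fin N)) U₀ c)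
    {c c'' : PBond P (j + 1)} (hc : c'' ≠ c) (X : (specialUnitaryLogChart (Fin N)).lie) :
    fderiv ℝ (fun (A : PBond P j → (specialUnitaryLogChart (Fin N)).lie) (c : PBond P (j + 1)) =>
      (isChartRep_specialUnitaryGroup (n := Fin N)).logChart
        (avgFun (expMeanLogSU (n := Fin N)) (fun b => (isChartRep_specialUnitaryGroup (n := Fin N)).expChart (A b) * U₀ b) c *
          (avgFun (expMeanLogSU (n := Fin N)) U₀ c)⁻¹)) 0
      (Pi.single (centralBond c) X) c'' = 0 := by
  apply Subtype.ext
  rw [coe_fderiv_chartRead_single_apply (P := P) (j := j) hsmall (centralBond c) c'' X, ZeroMemClass.coe_zero,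
    N07CentralDescendantLifts.fderiv_avgM_apply_eq_zero_of_supported_centralBond hj hc
      (fun i => norm_loopM_coeField_sub_one_lt_one U₀ c'' (hsmall c'') i) (fun b hb => by rw [Pi.single_eq_of_ne hb]), zero_mul]

omit [NeZero N] in
/-- Conjugation by a special unitary matrix preserves `𝔰𝔲(N) = {X⋆ = −X, tr X = 0}`. [cite: Balaban1985BackgroundPropagators, (3.29) p.395 (bookkeeping)] -/
theorem conj_mem_lie {g : Matrix (Fin N) (Fin N) ℂ} (hg : g ∈ Matrix.specialUnitaryGroup (Fin N) ℂ) {X : Matrix (Fin N) (Fin N) ℂ}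
    (hX : star X = -X ∧ X.trace = 0) : star (g * X * star g) = -(g * X * star g) ∧ (g * X * star g).trace = 0 := by
  refine ⟨?_, ?_⟩
  · rw [star_mul, star_mul, star_star, hX.1]; noncomm_ring
  · have h1 : star g * g = 1 := (Matrix.mem_specialUnitaryGroup_iff.1 hg).1.1
    rw [Matrix.trace_mul_cycle, h1, one_mul]; exact hX.2

/-- ★★★ **THE DIAGONAL BLOCKS ARE ONTO** (n07-w2's central response).  Under the loop `α`-guard AT `c` (`α ≤ 1∕24`, `α < δ_N`, `157·α < L^{1−d}`) and the guard elsewhere, every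
`z ∈ 𝔰𝔲(N)` is the `c`-component of the chart-read derivative on a direction supported at the central bond `β(c)`: `(Dψ_{U₀}(0)[X δ_{β(c)}])(c) = z` for some `X ∈ 𝔰𝔲(N)`
(`…N07CentralResponseOnto.centralResponse_onto_sharp`, conjugated by the left∕right chart conventions `X = Ad_{U₀(β)} Y`, `Y′ = Ad_{Ū(U₀)(c)}⁻¹ z`).
[cite: Balaban1985Averaging, Prop. 3 (124) p.36; Balaban1987RG1, (0.4), (0.8) p.253] -/
theorem exists_fderiv_chartRead_single_apply_self (hj : j + 1 ≤ P.m + P.K) (hsmall : ∀ c, Small (expMeanLogSU (n := Fin N)) U₀ c)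
    (c : PBond P (j + 1)) {α : ℝ} (hα : ∀ i, dist1 (loopHol U₀ c i) ≤ α) (hα24 : α ≤ 1 / 24) (hαδ : α < deltaSU (Fin N))
    (hαL : 157 * α < ((P.L : ℝ) ^ (P.d - 1))⁻¹) (z : (specialUnitaryLogChart (Fin N)).lie) :
    ∃ X : (specialUnitaryLogChart (Fin N)).lie,
      fderiv ℝ (fun (A : PBond P j → (specialUnitaryLogChart (Fin N)).lie) (c : PBond P (j + 1)) =>
        (isChartRep_specialUnitaryGroup (n := Fin N)).logChart
          (avgFun (expMeanLogSU (n := Fin N)) (fun b => (isChartRep_specialUnitaryGroup (n := Fin N)).expChart (A b) * U₀ b) c *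
            (avgFun (expMeanLogSU (n := Fin N)) U₀ c)⁻¹)) 0
        (Pi.single (centralBond c) X) c = z := by
  set g : Matrix (Fin N) (Fin N) ℂ := ((avgFun (expMeanLogSU (n := Fin N)) U₀ c : SU N) : Matrix (Fin N) (Fin N) ℂ) with hg
  set uβ : Matrix (Fin N) (Fin N) ℂ := ((U₀ (centralBond c) : SU N) : Matrix (Fin N) (Fin N) ℂ) with huβ
  have hgmem : g ∈ Matrix.specialUnitaryGroup (Fin N) ℂ := (avgFun (expMeanLogSU (n := Fin N)) U₀ c).2
  have huβmem : uβ ∈ Matrix.specialUnitaryGroup (Fin N) ℂ := (U₀ (centralBond c)).2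
  have hgstar : star g ∈ Matrix.specialUnitaryGroup (Fin N) ℂ := by rw [← coe_inv_SU]; exact ((avgFun (expMeanLogSU (n := Fin N)) U₀ c)⁻¹).2
  have hz : star (z : Matrix (Fin N) (Fin N) ℂ) = -(z : Matrix (Fin N) (Fin N) ℂ) ∧ (z : Matrix (Fin N) (Fin N) ℂ).trace = 0 :=
    mem_specialUnitaryLogChart_lie.1 z.2
  -- the target, pulled back to the tangent space at `1`: `Y′ = g⋆ z g`
  have hY'mem := conj_mem_lie (N := N) hgstar hz
  rw [star_star] at hY'mem
  set Y' : T4AdjointCovarianceUnitary.lieSU (Fin N) := ⟨star g * (z : Matrix (Fin N) (Fin N) ℂ) * g, T4AdjointCovarianceUnitary.mem_lieSU_iff.2 hY'mem⟩ with hY'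
  obtain ⟨Y, hY⟩ := N07CentralResponseOnto.centralResponse_onto_sharp hj U₀ c hα hα24 hαδ hαL Y'
  -- the direction: `X = uβ Y uβ⋆`, so that `X·uβ = uβ·Y`
  have hXmem := conj_mem_lie (N := N) huβmem (T4AdjointCovarianceUnitary.mem_lieSU_iff.1 Y.2)
  refine ⟨⟨uβ * (Y : Matrix (Fin N) (Fin N) ℂ) * star uβ, mem_specialUnitaryLogChart_lie.2 hXmem⟩, ?_⟩
  apply Subtype.ext
  rw [coe_fderiv_chartRead_single_apply (P := P) (j := j) hsmall (centralBond c) c]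
  have hXu : uβ * (Y : Matrix (Fin N) (Fin N) ℂ) * star uβ * uβ = uβ * (Y : Matrix (Fin N) (Fin N) ℂ) := by
    rw [mul_assoc, star_coe_mul_coe_SU, mul_one]
  show fderiv ℝ (fun W : PBond P j → Matrix (Fin N) (Fin N) ℂ => avgM W c) (coeField U₀)
      (Pi.single (centralBond c) (uβ * (Y : Matrix (Fin N) (Fin N) ℂ) * star uβ * uβ)) * star g = (z : Matrix (Fin N) (Fin N) ℂ)
  rw [hXu, hY]
  show g * (star g * (z : Matrix (Fin N) (Fin N) ℂ) * g) * star g = (z : Matrix (Fin N) (Fin N) ℂ)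
  have hgg : g * star g = 1 := coe_mul_star_coe_SU _
  calc g * (star g * (z : Matrix (Fin N) (Fin N) ℂ) * g) * star g
      = (g * star g) * (z : Matrix (Fin N) (Fin N) ℂ) * (g * star g) := by noncomm_ring
    _ = (z : Matrix (Fin N) (Fin N) ℂ) := by rw [hgg, one_mul, mul_one]

/-- ★★ **ONE COARSE BOND AT A TIME**: under the guards, for every `c` and `z ∈ 𝔰𝔲(N)` there is a direction supported at `β(c)` whose chart-read derivative is `z` at `c` and `0` at every
other coarse bond. [cite: Balaban1987RG1, (0.4) p.253; Balaban1985Averaging, Prop. 3 (124) p.36] -/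
theorem exists_fderiv_chartRead_single_eq_single (hj : j + 1 ≤ P.m + P.K) {α : ℝ} (hα : ∀ c i, dist1 (loopHol U₀ c i) ≤ α) (hα24 : α ≤ 1 / 24)
    (hαδ : α < deltaSU (Fin N)) (hαL : 157 * α < ((P.L : ℝ) ^ (P.d - 1))⁻¹) (c : PBond P (j + 1)) (z : (specialUnitaryLogChart (Fin N)).lie) :
    ∃ X : (specialUnitaryLogChart (Fin N)).lie,
      fderiv ℝ (fun (A : PBond P j → (specialUnitaryLogChart (Fin N)).lie) (c : PBond P (j + 1)) =>
        (isChartRep_specialUnitaryGroup (n := Fin N)).logChart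
          (avgFun (expMeanLogSU (n := Fin N)) (fun b => (isChartRep_specialUnitaryGroup (n := Fin N)).expChart (A b) * U₀ b) c *
            (avgFun (expMeanLogSU (n := Fin N)) U₀ c)⁻¹)) 0
        (Pi.single (centralBond c) X) = Pi.single c z := by
  have hsmall : ∀ c, Small (expMeanLogSU (n := Fin N)) U₀ c := fun c i => lt_of_le_of_lt (hα c i) hαδ
  obtain ⟨X, hX⟩ := exists_fderiv_chartRead_single_apply_self (P := P) (j := j) hj hsmall c (hα c) hα24 hαδ hαL z
  refine ⟨X, funext fun c'' => ?_⟩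
  by_cases hc : c'' = c
  · subst hc; rw [Pi.single_eq_same]; exact hX
  · rw [Pi.single_eq_of_ne hc]; exact fderiv_chartRead_single_apply_of_ne (P := P) (j := j) hj hsmall hc X

/-- ★★★ **(M3r)-LOCAL, SURJECTIVITY: THE CHART-READ (0.4) AVERAGE HAS ONTO DERIVATIVE AT `0`.**  For every fine configuration `U₀` in the standing range `j + 1 ≤ m + K` whose (0.4) loop
variables at every coarse bond are within `α` of `1`, `α ≤ 1∕24`, `α < δ_N`, `157·α < L^{1−d}`: `range Dψ_{U₀}(0) = ⊤` — the derivative is block-triangular on the central bonds with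
onto diagonal blocks (superpose one direction per coarse bond). [cite: Balaban1987RG1, (0.4), (0.8) p.253; Balaban1985Averaging, Prop. 3 (122)–(124) p.36] -/
theorem fderiv_chartRead_avgFun_range_eq_top (hj : j + 1 ≤ P.m + P.K) {α : ℝ} (hα : ∀ c i, dist1 (loopHol U₀ c i) ≤ α) (hα24 : α ≤ 1 / 24)
    (hαδ : α < deltaSU (Fin N)) (hαL : 157 * α < ((P.L : ℝ) ^ (P.d - 1))⁻¹) :
    LinearMap.range ((fderiv ℝ (fun (A : PBond P j → (specialUnitaryLogChart (Fin N)).lie) (c : PBond P (j + 1)) =>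
      (isChartRep_specialUnitaryGroup (n := Fin N)).logChart
        (avgFun (expMeanLogSU (n := Fin N)) (fun b => (isChartRep_specialUnitaryGroup (n := Fin N)).expChart (A b) * U₀ b) c *
          (avgFun (expMeanLogSU (n := Fin N)) U₀ c)⁻¹)) 0 :
        (PBond P j → (specialUnitaryLogChart (Fin N)).lie) →L[ℝ] (PBond P (j + 1) → (specialUnitaryLogChart (Fin N)).lie)) :
        (PBond P j → (specialUnitaryLogChart (Fin N)).lie) →ₗ[ℝ] (PBond P (j + 1) → (specialUnitaryLogChart (Fin N)).lie)) = ⊤ := by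
  classical
  set L := fderiv ℝ (fun (A : PBond P j → (specialUnitaryLogChart (Fin N)).lie) (c : PBond P (j + 1)) =>
      (isChartRep_specialUnitaryGroup (n := Fin N)).logChart
        (avgFun (expMeanLogSU (n := Fin N)) (fun b => (isChartRep_specialUnitaryGroup (n := Fin N)).expChart (A b) * U₀ b) c *
          (avgFun (expMeanLogSU (n := Fin N)) U₀ c)⁻¹)) 0 with hL
  refine LinearMap.range_eq_top.2 fun Z => ?_
  choose X hX using fun c => exists_fderiv_chartRead_single_eq_single (P := P) (j := j) hj hα hα24 hαδ hαL c (Z c)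
  refine ⟨∑ c, Pi.single (centralBond c) (X c), ?_⟩
  show L (∑ c, Pi.single (centralBond c) (X c)) = Z
  rw [map_sum]
  have hXc : ∀ c, L (Pi.single (centralBond c) (X c)) = Pi.single c (Z c) := fun c => hX c
  simp_rw [hXc]
  exact Finset.univ_sum_single Z

end Onto

/-! ## §4  The engine applied: the FLAT local face of the chart-read average, the local face on `SU(N)^B`, and the glued continuous density -/
section Face

variable {P : Params} {j : ℕ} {N : ℕ} [NeZero N]
variable (U₀ : GaugeField P j (SU N))
variable [MeasurableSpace (specialUnitaryLogChart (Fin N)).lie] [BorelSpace (specialUnitaryLogChart (Fin N)).lie]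

variable (η : Measure (specialUnitaryLogChart (Fin N)).lie) [η.IsAddHaarMeasure]

/-- ★★★ **(M3r)-LOCAL, ENGINE FORM: THE FLAT LOCAL JACOBIAN FACE OF THE CHART-READ (0.4) AVERAGE AT `0`.**  For every fine configuration `U₀` in the standing range
whose loop variables at every coarse bond are within `α` of `1` (`α ≤ 1∕24`, `α < δ_N`, `157·α < L^{1−d}`): there are open windows `O ∋ 0` in `𝔰𝔲(N)^{B_j}` and `D ∋ ψ(0)` in
`𝔰𝔲(N)^{B_{j+1}}` such that EVERY density `r ≥ 0`, measurable, continuous and bounded on `O` and vanishing off `O`, has under the chart-read average `ψ_{U₀}` a push-forward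
density w.r.t. `⊗η` that is CONTINUOUS on `D` — n09-w2's engine `SubmersionPushforward.exists_continuousOn_density_map_of_submersion` (implicit-function fibre coordinates,
[EvansGariepy1992] §3.4) applied to §2–§3. [cite: Balaban1987RG1, (2.1)–(2.10) pp.265–267; EvansGariepy1992, §3.4.2 Thm 1, §3.4.3 Thm 2] -/
theorem engineFace_chartRead_avgFun (hj : j + 1 ≤ P.m + P.K) {α : ℝ} (hα : ∀ c i, dist1 (loopHol U₀ c i) ≤ α) (hα24 : α ≤ 1 / 24)
    (hαδ : α < deltaSU (Fin N)) (hαL : 157 * α < ((P.L : ℝ) ^ (P.d - 1))⁻¹) :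
    ∃ O : Set (PBond P j → (specialUnitaryLogChart (Fin N)).lie), IsOpen O ∧ (0 : PBond P j → (specialUnitaryLogChart (Fin N)).lie) ∈ O ∧
      ∃ D : Set (PBond P (j + 1) → (specialUnitaryLogChart (Fin N)).lie), IsOpen D ∧
      (fun (A : PBond P j → (specialUnitaryLogChart (Fin N)).lie) (c : PBond P (j + 1)) =>
        (isChartRep_specialUnitaryGroup (n := Fin N)).logChart
          (avgFun (expMeanLogSU (n := Fin N)) (fun b => (isChartRep_specialUnitaryGroup (n := Fin N)).expChart (A b) * U₀ b) c *
            (avgFun (expMeanLogSU (n := Fin N)) U₀ c)⁻¹)) 0 ∈ D ∧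
      ∀ r : (PBond P j → (specialUnitaryLogChart (Fin N)).lie) → ℝ, Measurable r → (∀ A, 0 ≤ r A) → ContinuousOn r O →
        (∃ C₀ : ℝ, ∀ A ∈ O, r A ≤ C₀) → (∀ A, A ∉ O → r A = 0) →
        ∃ I : (PBond P (j + 1) → (specialUnitaryLogChart (Fin N)).lie) → ℝ, ContinuousOn I D ∧ (∀ w, 0 ≤ I w) ∧
          ∀ A' : Set (PBond P (j + 1) → (specialUnitaryLogChart (Fin N)).lie), MeasurableSet A' → A' ⊆ D →
            ((Measure.pi fun _ : PBond P j => η).withDensity fun A => ENNReal.ofReal (r A))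
                ((fun (A : PBond P j → (specialUnitaryLogChart (Fin N)).lie) (c : PBond P (j + 1)) =>
                  (isChartRep_specialUnitaryGroup (n := Fin N)).logChart
                    (avgFun (expMeanLogSU (n := Fin N)) (fun b => (isChartRep_specialUnitaryGroup (n := Fin N)).expChart (A b) * U₀ b) c *
                      (avgFun (expMeanLogSU (n := Fin N)) U₀ c)⁻¹)) ⁻¹' A') =
              ∫⁻ w in A', ENNReal.ofReal (I w) ∂(Measure.pi fun _ : PBond P (j + 1) => η) := by
  haveI : (Measure.pi fun _ : PBond P j => η).IsAddHaarMeasure := Measure.pi.isAddHaarMeasure _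
  haveI : (Measure.pi fun _ : PBond P (j + 1) => η).IsAddHaarMeasure := Measure.pi.isAddHaarMeasure _
  have hsmall : ∀ c, Small (expMeanLogSU (n := Fin N)) U₀ c := fun c i => lt_of_le_of_lt (hα c i) hαδ
  exact Literature.MeasureTheory.Integral.SubmersionPushforward.exists_continuousOn_density_map_of_submersion
    (Measure.pi fun _ : PBond P j => η) (Measure.pi fun _ : PBond P (j + 1) => η)
    (measurable_chartRead_avgFun (P := P) (j := j) U₀)
    ((contDiffAt_chartRead_avgFun (P := P) (j := j) U₀ hsmall).of_le le_top)
    (fderiv_chartRead_avgFun_range_eq_top (P := P) (j := j) hj hα hα24 hαδ hαL)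

/-- ★★★ **THE FLAT LOCAL FACE IN THE `hflat` SHAPE OF n09-w2's `localFace_pi_haar_of_chartRead` ∕ `exists_continuous_density_pi_haar_of_flatLocalFaces`** (idle exemption
`Q ≡ True`, i.e. densities continuous on the window; the bridge is n09-w2's `flatFace_chartRead_of_engineFace`, `ψ(0) = 0`).
[cite: Balaban1987RG1, (2.1)–(2.10) pp.265–267; Helgason2000, Ch. I §1 Thm. 1.14 (13) p. 96 (bookkeeping)] -/
theorem flatFace_chartRead_avgFun (hj : j + 1 ≤ P.m + P.K) {α : ℝ} (hα : ∀ c i, dist1 (loopHol U₀ c i) ≤ α) (hα24 : α ≤ 1 / 24)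
    (hαδ : α < deltaSU (Fin N)) (hαL : 157 * α < ((P.L : ℝ) ^ (P.d - 1))⁻¹) :
    ∃ O : Set (PBond P j → (specialUnitaryLogChart (Fin N)).lie), ∃ D : Set (PBond P (j + 1) → (specialUnitaryLogChart (Fin N)).lie),
      IsOpen O ∧ (0 : PBond P j → (specialUnitaryLogChart (Fin N)).lie) ∈ O ∧ IsOpen D ∧ (0 : PBond P (j + 1) → (specialUnitaryLogChart (Fin N)).lie) ∈ D ∧
      ∀ r : (PBond P j → (specialUnitaryLogChart (Fin N)).lie) → ℝ, Measurable r → (∀ A, 0 ≤ r A) →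
        (∀ A ∈ O, (fun _ : GaugeField P j (SU N) => True) (fun b => (isChartRep_specialUnitaryGroup (n := Fin N)).expChart (A b) * U₀ b) → ContinuousAt r A) →
        (∃ C₀ : ℝ, ∀ A, r A ≤ C₀) → (∀ A, A ∉ O → r A = 0) →
        ∃ I : (PBond P (j + 1) → (specialUnitaryLogChart (Fin N)).lie) → ℝ, ContinuousOn I D ∧ (∀ w, 0 ≤ I w) ∧
          ∀ A' : Set (PBond P (j + 1) → (specialUnitaryLogChart (Fin N)).lie), MeasurableSet A' → A' ⊆ D →
            ((Measure.pi fun _ : PBond P j => η).withDensity fun A => ENNReal.ofReal (r A))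
                ((fun (A : PBond P j → (specialUnitaryLogChart (Fin N)).lie) (c : PBond P (j + 1)) =>
                  (isChartRep_specialUnitaryGroup (n := Fin N)).logChart
                    (avgFun (expMeanLogSU (n := Fin N)) (fun b => (isChartRep_specialUnitaryGroup (n := Fin N)).expChart (A b) * U₀ b) c *
                      (avgFun (expMeanLogSU (n := Fin N)) U₀ c)⁻¹)) ⁻¹' A') =
              ∫⁻ w in A', ENNReal.ofReal (I w) ∂(Measure.pi fun _ : PBond P (j + 1) => η) :=
  (isChartRep_specialUnitaryGroup (n := Fin N)).flatFace_chartRead_of_engineFace (Measure.pi fun _ : PBond P j => η)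
    (Measure.pi fun _ : PBond P (j + 1) => η) U₀
    (Λ' := fun (V : GaugeField P (j + 1) (SU N)) (c : PBond P (j + 1)) =>
      (isChartRep_specialUnitaryGroup (n := Fin N)).logChart (V c * (avgFun (expMeanLogSU (n := Fin N)) U₀ c)⁻¹))
    ((isChartRep_specialUnitaryGroup (n := Fin N)).piLogChart_translate_self (M := avgFun (expMeanLogSU (n := Fin N))) U₀)
    (engineFace_chartRead_avgFun (P := P) (j := j) U₀ η hj hα hα24 hαδ hαL)

end Face

section FaceGroup
variable {P : Params} {j : ℕ} {N : ℕ} [NeZero N]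
variable (U₀ : GaugeField P j (SU N))

/-- ★★★ **THE LOCAL JACOBIAN FACE OF THE (0.4) AVERAGING ON `SU(N)^{B_j}` AT EVERY CONFIGURATION OF THE α-GUARD** — n09-w2's chart transport `localFace_pi_haar_of_chartRead` fed
with the flat face above: open `W ∋ U₀`, `DG ∋ Ū(U₀)` such that every measurable bounded continuous `r ≥ 0` vanishing off `W` has under `Ū = avgFun expMeanLogSU` a push-forward density
w.r.t. the product Haar measures that is CONTINUOUS on `DG` (VERBATIM the per-point clause `hloc` of `PushforwardDensityGluing.exists_continuous_density_of_locally'` with the idle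
exemption). [cite: Balaban1987RG1, (2.10) p.267 (measure-level reading); Helgason2000, Ch. I §1 Thm. 1.14 (13) p. 96; Balaban1985UV3, (18) p. 260] -/
theorem localFace_avgFun_of_loopSmall (hj : j + 1 ≤ P.m + P.K) {α : ℝ} (hα : ∀ c i, dist1 (loopHol U₀ c i) ≤ α) (hα24 : α ≤ 1 / 24)
    (hαδ : α < deltaSU (Fin N)) (hαL : 157 * α < ((P.L : ℝ) ^ (P.d - 1))⁻¹) :
    ∃ W : Set (GaugeField P j (SU N)), ∃ DG : Set (GaugeField P (j + 1) (SU N)),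
      ContinuousAt (avgFun (expMeanLogSU (n := Fin N)) : GaugeField P j (SU N) → GaugeField P (j + 1) (SU N)) U₀ ∧ IsOpen W ∧ U₀ ∈ W ∧ IsOpen DG ∧
      avgFun (expMeanLogSU (n := Fin N)) U₀ ∈ DG ∧
      ∀ r : GaugeField P j (SU N) → ℝ, Measurable r → (∀ U, 0 ≤ r U) → (∀ U, (U ∈ W → (fun _ : GaugeField P j (SU N) => True) U) → ContinuousAt r U) →
        (∃ C₀ : ℝ, ∀ U, r U ≤ C₀) → (∀ U, U ∉ W → r U = 0) →
        ∃ I : GaugeField P (j + 1) (SU N) → ℝ, ContinuousOn I DG ∧ (∀ V, 0 ≤ I V) ∧ ∀ S' : Set (GaugeField P (j + 1) (SU N)), MeasurableSet S' → S' ⊆ DG →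
          ((Measure.pi fun _ : PBond P j => (HaarData.haar : Measure (SU N))).withDensity fun U => ENNReal.ofReal (r U))
              ((avgFun (expMeanLogSU (n := Fin N)) : GaugeField P j (SU N) → GaugeField P (j + 1) (SU N)) ⁻¹' S') =
            ∫⁻ V in S', ENNReal.ofReal (I V) ∂(Measure.pi fun _ : PBond P (j + 1) => (HaarData.haar : Measure (SU N))) := by
  letI : MeasurableSpace (specialUnitaryLogChart (Fin N)).lie := borel _
  haveI : BorelSpace (specialUnitaryLogChart (Fin N)).lie := ⟨rfl⟩
  let η : Measure (specialUnitaryLogChart (Fin N)).lie := (Module.finBasis ℝ (specialUnitaryLogChart (Fin N)).lie).addHaar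
  haveI := FieldMeasureExpChartChangeOfVariables.isHaarMeasure_haar_specialUnitaryGroup (N := N)
  haveI : (HaarData.haar : Measure (SU N)).IsMulRightInvariant := FieldMeasureExpChartChangeOfVariables.isMulRightInvariant_haar
  have hsmall : ∀ c, Small (expMeanLogSU (n := Fin N)) U₀ c := fun c i => lt_of_le_of_lt (hα c i) hαδ
  exact (isChartRep_specialUnitaryGroup (n := Fin N)).localFace_pi_haar_of_chartRead (lie_adStable_specialUnitaryGroup (n := Fin N)) η
    (HaarData.haar : Measure (SU N)) (BlockAveraging.measurable_avgFun _ ExpMeanLog.measurable_expMeanLogSU_E) U₀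
    (continuousAt_avgFun_of_small (P := P) (j := j) U₀ hsmall) (fun _ => True)
    (flatFace_chartRead_avgFun (P := P) (j := j) U₀ η hj hα hα24 hαδ hαL)

variable {U₀}

/-- ★★★ **THE LOCAL ROUTE ASSEMBLED FOR THE (0.4) AVERAGING: CONTINUOUS DENSITIES ON THE α-GUARD ARE TRANSFORMED TO CONTINUOUS DENSITIES.**  For every CLOSED set `K` of
fine configurations inside the α-guard (`α ≤ 1∕24`, `α < δ_N`, `157·α < L^{1−d}`; standing range `j + 1 ≤ m + K`) and every measurable bounded `r ≥ 0` vanishing off `K` and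
continuous at each point of `K`: the push-forward of `r · Π_b dU(b)` under `Ū = avgFun expMeanLogSU` has a density `g ≥ 0` CONTINUOUS ON ALL OF `SU(N)^{B_{j+1}}` w.r.t. `Π_c dV(c)`,
with the set identity and the (0.13)-shaped test identity `∫ r·(f∘Ū) Π dU = ∫ g·f Π dV` for every measurable real `f` (n09-w2's gluing `exists_continuous_density_pi_haar_of_flatLocalFaces`
over §4's faces). [cite: Balaban1987RG1, (0.13) p.254, (2.10) p.267; HormanderALPDO1, §6.1; EvansGariepy1992, §3.4.3] -/
theorem exists_continuous_density_avgFun_of_loopSmall (hj : j + 1 ≤ P.m + P.K) {α : ℝ} (hα24 : α ≤ 1 / 24) (hαδ : α < deltaSU (Fin N))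
    (hαL : 157 * α < ((P.L : ℝ) ^ (P.d - 1))⁻¹) {K : Set (GaugeField P j (SU N))} (hK : IsClosed K)
    (hKα : ∀ U ∈ K, ∀ c i, dist1 (loopHol U c i) ≤ α)
    (r : GaugeField P j (SU N) → ℝ) (hrm : Measurable r) (hr0 : ∀ U, 0 ≤ r U) (hrc : ∀ U ∈ K, ContinuousAt r U)
    (hrC : ∃ C₀ : ℝ, ∀ U, r U ≤ C₀) (hrK : ∀ U, U ∉ K → r U = 0) :
    ∃ g : GaugeField P (j + 1) (SU N) → ℝ, Continuous g ∧ (∀ V, 0 ≤ g V) ∧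
      (∀ S' : Set (GaugeField P (j + 1) (SU N)), MeasurableSet S' →
        ((Measure.pi fun _ : PBond P j => (HaarData.haar : Measure (SU N))).withDensity fun U => ENNReal.ofReal (r U))
            ((avgFun (expMeanLogSU (n := Fin N)) : GaugeField P j (SU N) → GaugeField P (j + 1) (SU N)) ⁻¹' S') =
          ∫⁻ V in S', ENNReal.ofReal (g V) ∂(Measure.pi fun _ : PBond P (j + 1) => (HaarData.haar : Measure (SU N)))) ∧
      ∀ f : GaugeField P (j + 1) (SU N) → ℝ, Measurable f →
        ∫ U, r U * f (avgFun (expMeanLogSU (n := Fin N)) U) ∂(Measure.pi fun _ : PBond P j => (HaarData.haar : Measure (SU N))) =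
          ∫ V, g V * f V ∂(Measure.pi fun _ : PBond P (j + 1) => (HaarData.haar : Measure (SU N))) := by
  letI : MeasurableSpace (specialUnitaryLogChart (Fin N)).lie := borel _
  haveI : BorelSpace (specialUnitaryLogChart (Fin N)).lie := ⟨rfl⟩
  let η : Measure (specialUnitaryLogChart (Fin N)).lie := (Module.finBasis ℝ (specialUnitaryLogChart (Fin N)).lie).addHaar
  haveI := FieldMeasureExpChartChangeOfVariables.isHaarMeasure_haar_specialUnitaryGroup (N := N)
  haveI : (HaarData.haar : Measure (SU N)).IsMulRightInvariant := FieldMeasureExpChartChangeOfVariables.isMulRightInvariant_haar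
  refine (isChartRep_specialUnitaryGroup (n := Fin N)).exists_continuous_density_pi_haar_of_flatLocalFaces (lie_adStable_specialUnitaryGroup (n := Fin N)) η
    (HaarData.haar : Measure (SU N)) (BlockAveraging.measurable_avgFun _ ExpMeanLog.measurable_expMeanLogSU_E) (fun _ => True) hK
    (fun U₀ hU₀ => ⟨continuousAt_avgFun_of_small (P := P) (j := j) U₀ fun c i => lt_of_le_of_lt (hKα U₀ hU₀ c i) hαδ,
      flatFace_chartRead_avgFun (P := P) (j := j) U₀ η hj (hKα U₀ hU₀) hα24 hαδ hαL⟩)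
    r hrm hr0 (fun U hU _ => hrc U hU) hrC hrK

end FaceGroup
/-! ## §5  At NODE 00's objects: `avOfRecord F N K k` (= `blockAvg expMeanLogSU`, `rfl`) and `fieldMeasure = Π_b dU(b)` (`rfl`), `k < K` -/

section Record

variable {F : T4Continuum.T4Family} {N : ℕ} [NeZero N] {K k : ℕ}
variable [MeasurableSpace (specialUnitaryLogChart (Fin N)).lie] [BorelSpace (specialUnitaryLogChart (Fin N)).lie]
  (η : Measure (specialUnitaryLogChart (Fin N)).lie) [η.IsAddHaarMeasure]

/-- ★★★ **(M3r)-LOCAL AT THE RECORD — the per-configuration input of n09-w2's `Node00.RegSetOfLocalFaces` §2, idle exemption**: at every fine configuration `U₀` of the α-guard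
(`k < K`): `ContinuousAt (avOfRecord F N K k).avg U₀` AND the FLAT engine-form local face at `0` of `A ↦ (c ↦ Λ(Ū(Θ^B(A)·U₀)(c)·Ū(U₀)(c)⁻¹))` w.r.t. `⊗η`.
[cite: Balaban1987RG1, (0.4) p.253, (2.1)–(2.10) pp.265–267; EvansGariepy1992, §3.4.3 Thm 2] -/
theorem continuousAt_and_flatFace_avOfRecord (hk : k < K) (U₀ : cfgOfRecord F N K k) {α : ℝ} (hα : ∀ c i, dist1 (loopHol U₀ c i) ≤ α)
    (hα24 : α ≤ 1 / 24) (hαδ : α < deltaSU (Fin N)) (hαL : 157 * α < (((F.P K).L : ℝ) ^ ((F.P K).d - 1))⁻¹) :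
    ContinuousAt (avOfRecord F N K k).avg U₀ ∧
    ∃ O : Set (PBond (F.P K) k → (specialUnitaryLogChart (Fin N)).lie), ∃ D : Set (PBond (F.P K) (k + 1) → (specialUnitaryLogChart (Fin N)).lie),
      IsOpen O ∧ (0 : PBond (F.P K) k → (specialUnitaryLogChart (Fin N)).lie) ∈ O ∧ IsOpen D ∧
      (0 : PBond (F.P K) (k + 1) → (specialUnitaryLogChart (Fin N)).lie) ∈ D ∧
      ∀ r : (PBond (F.P K) k → (specialUnitaryLogChart (Fin N)).lie) → ℝ, Measurable r → (∀ A, 0 ≤ r A) →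
        (∀ A ∈ O, (fun _ : cfgOfRecord F N K k => True) (fun b => (isChartRep_specialUnitaryGroup (n := Fin N)).expChart (A b) * U₀ b) → ContinuousAt r A) →
        (∃ C₀ : ℝ, ∀ A, r A ≤ C₀) → (∀ A, A ∉ O → r A = 0) →
        ∃ I : (PBond (F.P K) (k + 1) → (specialUnitaryLogChart (Fin N)).lie) → ℝ, ContinuousOn I D ∧ (∀ w, 0 ≤ I w) ∧
          ∀ A' : Set (PBond (F.P K) (k + 1) → (specialUnitaryLogChart (Fin N)).lie), MeasurableSet A' → A' ⊆ D →
            ((Measure.pi fun _ : PBond (F.P K) k => η).withDensity fun A => ENNReal.ofReal (r A))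
                ((fun (A : PBond (F.P K) k → (specialUnitaryLogChart (Fin N)).lie) (c : PBond (F.P K) (k + 1)) =>
                  (isChartRep_specialUnitaryGroup (n := Fin N)).logChart
                    ((avOfRecord F N K k).avg (fun b => (isChartRep_specialUnitaryGroup (n := Fin N)).expChart (A b) * U₀ b) c *
                      ((avOfRecord F N K k).avg U₀ c)⁻¹)) ⁻¹' A') =
              ∫⁻ w in A', ENNReal.ofReal (I w) ∂(Measure.pi fun _ : PBond (F.P K) (k + 1) => η) := by
  have hsmall : ∀ c, Small (expMeanLogSU (n := Fin N)) U₀ c := fun c i => lt_of_le_of_lt (hα c i) hαδ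
  have hj : k + 1 ≤ (F.P K).m + (F.P K).K := by simp only [T4Continuum.T4Family.P_K]; omega
  exact ⟨continuousAt_avgFun_of_small (P := F.P K) (j := k) U₀ hsmall,
    flatFace_chartRead_avgFun (P := F.P K) (j := k) U₀ η hj hα hα24 hαδ hαL⟩

omit [MeasurableSpace (specialUnitaryLogChart (Fin N)).lie] [BorelSpace (specialUnitaryLogChart (Fin N)).lie] in
/-- ★★★ **AT THE RECORD: the renormalisation transform of a CONTINUOUS density supported in the α-guard has a CONTINUOUS density** — for `k < K`, every closed `K₀` of
level-`k` configurations of the `K`-th torus inside the α-guard and every measurable bounded `ρ ≥ 0` vanishing off `K₀` and continuous on `K₀`: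
`∃ g ≥ 0` continuous on ALL of `cfgOfRecord F N K (k+1)` with `(ρ·dU)(Ū⁻¹S) = ∫_S g dV` (all measurable `S`) and `∫ ρ·(f∘Ū) dU = ∫ g·f dV` (all measurable real `f`), `dU`∕`dV` the
field measures of record (`fieldMeasure = Π haar`, `rfl`). [cite: Balaban1987RG1, (0.13) p.254, (2.10) p.267; Balaban1985Averaging, (10) p.19] -/
theorem exists_continuous_density_TOfRecord_of_loopSmall (hk : k < K) {α : ℝ} (hα24 : α ≤ 1 / 24) (hαδ : α < deltaSU (Fin N))
    (hαL : 157 * α < (((F.P K).L : ℝ) ^ ((F.P K).d - 1))⁻¹) {K₀ : Set (cfgOfRecord F N K k)} (hK₀ : IsClosed K₀)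
    (hK₀α : ∀ U ∈ K₀, ∀ c i, dist1 (loopHol U c i) ≤ α)
    (ρ : cfgOfRecord F N K k → ℝ) (hρm : Measurable ρ) (hρ0 : ∀ U, 0 ≤ ρ U) (hρc : ∀ U ∈ K₀, ContinuousAt ρ U)
    (hρC : ∃ C₀ : ℝ, ∀ U, ρ U ≤ C₀) (hρK : ∀ U, U ∉ K₀ → ρ U = 0) :
    ∃ g : cfgOfRecord F N K (k + 1) → ℝ, Continuous g ∧ (∀ V, 0 ≤ g V) ∧
      (∀ S' : Set (cfgOfRecord F N K (k + 1)), MeasurableSet S' →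
        ((fieldMeasure (F.P K) k (SU N)).withDensity fun U => ENNReal.ofReal (ρ U)) ((avOfRecord F N K k).avg ⁻¹' S') =
          ∫⁻ V in S', ENNReal.ofReal (g V) ∂(fieldMeasure (F.P K) (k + 1) (SU N))) ∧
      ∀ f : cfgOfRecord F N K (k + 1) → ℝ, Measurable f →
        ∫ U, ρ U * f ((avOfRecord F N K k).avg U) ∂(fieldMeasure (F.P K) k (SU N)) =
          ∫ V, g V * f V ∂(fieldMeasure (F.P K) (k + 1) (SU N)) := by
  have hj : k + 1 ≤ (F.P K).m + (F.P K).K := by simp only [T4Continuum.T4Family.P_K]; omega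
  rw [FieldMeasureExpChartChangeOfVariables.fieldMeasure_eq_pi, FieldMeasureExpChartChangeOfVariables.fieldMeasure_eq_pi]
  exact exists_continuous_density_avgFun_of_loopSmall (P := F.P K) (j := k) hj hα24 hαδ hαL hK₀ hK₀α ρ hρm hρ0 hρc hρC hρK

end Record

end Summit.QuantumFields.YangMills.BalabanUVNodes.N09ChartReadAveragingSubmersion
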